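import Literature.Analysis.Complex.SchwarzReflection
import Mathlib.Analysis.Complex.ReImTopology
import HarnessLib

/-!
# Uniqueness of holomorphic functions on the upper half-plane from a boundary segment

Analysis/Complex support file (everything proved). If `f` is holomorphic on the open upper
half-plane `{im z > 0}`, continuous from above at the points of a real interval `(a, b)` and zero
there, then `f` vanishes identically on the upper half-plane
(`eq_zero_of_eqOn_real_segment`); two such functions agreeing on `(a, b)` agree on the half-plane
(`eqOn_of_eqOn_real_segment`); and the LOCAL half-disc form (`eqOn_zero_of_eqOn_real_diameter`:
holomorphic only on `B(x₀, r) ∩ {im z > 0}`, continuous from above and zero on the diameter ⟹ zero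
on the half-disc), to be combined with the identity theorem on the user's own domain. This is the continuous case of the boundary uniqueness theorem
(Privalov; W. Rudin, *Real and Complex Analysis*, Thm. 17.18 for `H^p`), proved here in the
classical elementary way: reflect across the segment (the Schwarz reflection principle,
`Complex.differentiableOn_schwarzReflection` of `SchwarzReflection.lean`, i.e. Painlevé's theorem
for a line), so that the zeros accumulate at an INTERIOR point of the reflected domain, and apply
the identity theorem twice (in the disc, then in the half-plane). Used for the analytic
continuation of operator identities from a half-line in the proof of the half-sided modular
inclusion theorem (R. Longo, *Lectures on Conformal Nets* I, Thm. 2.4.1).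

## References
* J. B. Conway, *Functions of One Complex Variable I* (1978), Ch. IX Thm. 1.1 (reflection).
  [Conway1978]
* W. Rudin, *Real and Complex Analysis*, 3rd ed. (1987), Thm. 11.14 and Thm. 17.18.
-/

noncomputable section

open Set Filter Metric Complex
open _root_.Topology
open scoped ComplexConjugate

namespace Literature.Analysis.Complex

/-- Real points of a disc centred on the real axis lie in the corresponding real interval. [folklore] -/
theorem ofReal_mem_ball_iff {x₀ r : ℝ} {x : ℝ} : (x : ℂ) ∈ ball (x₀ : ℂ) r ↔ x ∈ Ioo (x₀ - r) (x₀ + r) := by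
  rw [mem_ball, Complex.dist_eq, ← ofReal_sub, Complex.norm_real, Real.norm_eq_abs, mem_Ioo,
    abs_sub_lt_iff]
  constructor <;> intro h <;> constructor <;> linarith [h.1, h.2]

/-- A disc centred on the real axis is symmetric under conjugation. [folklore] -/
theorem conj_mem_ball_ofReal {x₀ r : ℝ} {z : ℂ} (hz : z ∈ ball (x₀ : ℂ) r) : conj z ∈ ball (x₀ : ℂ) r := by
  rw [mem_ball] at hz ⊢
  rwa [← conj_ofReal, Complex.dist_conj_conj]

/-- **Boundary uniqueness from a real segment for the upper half-plane.** Let `f` be holomorphic on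
`{im z > 0}`, continuous from the closed upper half-plane at every point of the real interval
`(a, b)`, and zero on `(a, b)`. Then `f = 0` on `{im z > 0}` (Schwarz reflection across the
segment, isolated zeros, identity theorem). [cite: Conway1978, Ch. IX Thm. 1.1] -/
theorem eq_zero_of_eqOn_real_segment {f : ℂ → ℂ} {a b : ℝ} (hab : a < b)
    (hd : DifferentiableOn ℂ f {z : ℂ | 0 < z.im})
    (hc : ∀ x : ℝ, x ∈ Ioo a b → ContinuousWithinAt f {z : ℂ | 0 ≤ z.im} x)
    (h0 : ∀ x : ℝ, x ∈ Ioo a b → f x = 0) {z : ℂ} (hz : 0 < z.im) : f z = 0 := by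
  -- the disc `B(x₀, r)` on the segment
  set x₀ : ℝ := (a + b) / 2 with hx₀
  set r : ℝ := (b - a) / 2 with hr
  have hr0 : 0 < r := by rw [hr]; linarith
  have hreal : ∀ x : ℝ, (x : ℂ) ∈ ball (x₀ : ℂ) r → x ∈ Ioo a b := by
    intro x hx
    have h := ofReal_mem_ball_iff.1 hx
    rw [hx₀, hr] at h
    constructor <;> linarith [h.1, h.2]
  have hU : IsOpen (ball (x₀ : ℂ) r) := isOpen_ball
  -- Step 1: the reflected function is holomorphic on the disc
  have hF : DifferentiableOn ℂ (_root_.Complex.schwarzReflection f) (ball (x₀ : ℂ) r) := by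
    refine _root_.Complex.differentiableOn_schwarzReflection hU (fun w hw => conj_mem_ball_ofReal hw)
      ?_ (hd.mono inter_subset_right) ?_
    · rintro w ⟨hwU, hw⟩
      rcases eq_or_lt_of_le (show 0 ≤ w.im from hw) with him | him
      · -- a real point of the segment
        obtain ⟨x, rfl⟩ : ∃ x : ℝ, (x : ℂ) = w :=
          ⟨w.re, Complex.ext (by simp) (by rw [ofReal_im]; exact him)⟩
        exact (hc x (hreal x hwU)).mono inter_subset_right
      · exact (hd.differentiableAt ((isOpen_lt continuous_const continuous_im).mem_nhds him)).continuousAt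
          |>.continuousWithinAt
    · intro w hwU hwim
      obtain ⟨x, rfl⟩ : ∃ x : ℝ, (x : ℂ) = w := ⟨w.re, Complex.ext (by simp) (by simp [hwim])⟩
      rw [h0 x (hreal x hwU), map_zero]
  have hFa : AnalyticOnNhd ℂ (_root_.Complex.schwarzReflection f) (ball (x₀ : ℂ) r) :=
    hF.analyticOnNhd hU
  -- Step 2: the reflected function vanishes near `x₀` (isolated zeros along the real axis)
  have hx₀mem : ((x₀ : ℝ) : ℂ) ∈ ball (x₀ : ℂ) r := mem_ball_self hr0
  have hFzero : ∀ x : ℝ, (x : ℂ) ∈ ball (x₀ : ℂ) r → _root_.Complex.schwarzReflection f x = 0 := by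
    intro x hx
    rw [_root_.Complex.schwarzReflection_ofReal, h0 x (hreal x hx)]
  have hev : ∀ᶠ w in 𝓝 ((x₀ : ℝ) : ℂ), _root_.Complex.schwarzReflection f w = 0 := by
    refine ((hFa _ hx₀mem).frequently_zero_iff_eventually_zero).1 ?_
    have hrealev : ∀ᶠ t : ℝ in 𝓝 x₀, _root_.Complex.schwarzReflection f t = 0 := by
      have : ∀ᶠ t : ℝ in 𝓝 x₀, (t : ℂ) ∈ ball (x₀ : ℂ) r :=
        Complex.continuous_ofReal.continuousAt.preimage_mem_nhds (hU.mem_nhds hx₀mem)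
      filter_upwards [this] with t ht using hFzero t ht
    have htend : Tendsto (fun t : ℝ => (t : ℂ)) (𝓝[≠] x₀) (𝓝[≠] ((x₀ : ℝ) : ℂ)) := by
      refine Complex.continuous_ofReal.continuousWithinAt.tendsto_nhdsWithin ?_
      intro t ht
      simpa using ht
    simpa using htend.frequently (eventually_nhdsWithin_of_eventually_nhds hrealev).frequently
  have hFball : EqOn (_root_.Complex.schwarzReflection f) 0 (ball (x₀ : ℂ) r) :=
    hFa.eqOn_zero_of_preconnected_of_eventuallyEq_zero (convex_ball _ _).isPreconnected hx₀mem hev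
  -- Step 3: `f` vanishes near the interior point `x₀ + (r/2) i` of the half-plane
  set w₀ : ℂ := (x₀ : ℂ) + (r / 2 : ℝ) * I with hw₀
  have hw₀im : 0 < w₀.im := by simp [hw₀, hr0]
  have hw₀ball : w₀ ∈ ball (x₀ : ℂ) r := by
    rw [mem_ball, dist_eq_norm, hw₀, add_sub_cancel_left, norm_mul, Complex.norm_real, norm_I, mul_one,
      Real.norm_eq_abs, abs_of_pos (by positivity)]
    linarith
  have hfev : ∀ᶠ w in 𝓝 w₀, f w = 0 := by
    filter_upwards [hU.mem_nhds hw₀ball, (isOpen_lt continuous_const continuous_im).mem_nhds hw₀im]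
      with w hw hwim
    have h1 := hFball hw
    rw [Pi.zero_apply, _root_.Complex.schwarzReflection_of_nonneg (le_of_lt hwim)] at h1
    exact h1
  -- Step 4: identity theorem on the (connected) upper half-plane
  have hopen : IsOpen {z : ℂ | 0 < z.im} := isOpen_lt continuous_const continuous_im
  exact (hd.analyticOnNhd hopen).eqOn_zero_of_preconnected_of_eventuallyEq_zero
    (convex_halfSpace_im_gt 0).isPreconnected hw₀im hfev hz

/-- **Two holomorphic functions on the upper half-plane which are continuous from above at, and
agree on, a real segment agree on the half-plane.** [cite: Conway1978, Ch. IX Thm. 1.1] -/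
theorem eqOn_of_eqOn_real_segment {f g : ℂ → ℂ} {a b : ℝ} (hab : a < b)
    (hf : DifferentiableOn ℂ f {z : ℂ | 0 < z.im}) (hg : DifferentiableOn ℂ g {z : ℂ | 0 < z.im})
    (hfc : ∀ x : ℝ, x ∈ Ioo a b → ContinuousWithinAt f {z : ℂ | 0 ≤ z.im} x)
    (hgc : ∀ x : ℝ, x ∈ Ioo a b → ContinuousWithinAt g {z : ℂ | 0 ≤ z.im} x)
    (h : ∀ x : ℝ, x ∈ Ioo a b → f x = g x) {z : ℂ} (hz : 0 < z.im) : f z = g z := by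
  have := eq_zero_of_eqOn_real_segment hab (hf.sub hg) (fun x hx => (hfc x hx).sub (hgc x hx))
    (fun x hx => by simp [h x hx]) hz
  exact sub_eq_zero.1 this

/-- **Local boundary uniqueness from a real diameter (half-disc form).** Let `f` be holomorphic on
the open upper half `B(x₀, r) ∩ {im z > 0}` of a disc centred at a real point `x₀`, continuous from
the closed upper half-plane at every real point of the disc, and zero at those points. Then `f = 0`
on the upper half-disc. (Schwarz reflection across the diameter — the reflected function is
holomorphic on the whole disc, `Complex.differentiableOn_schwarzReflection` — and the identity
theorem in the disc, where the zeros on the diameter accumulate at `x₀`.) This is the LOCAL form of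
`eq_zero_of_eqOn_real_segment` (which asks holomorphy on the whole upper half-plane): combine it
with the identity theorem on any connected domain lying over the segment, e.g. a strip after a
rotation (as in `Literature.NumberTheory.LFunctions.BaezDuarteMellin.eq_zero_of_eqOn_boundary_segment`).
[cite: Conway1978, Ch. IX Thm. 1.1] -/
theorem eqOn_zero_of_eqOn_real_diameter {f : ℂ → ℂ} {x₀ r : ℝ} (hr : 0 < r)
    (hd : DifferentiableOn ℂ f (ball (x₀ : ℂ) r ∩ {z : ℂ | 0 < z.im}))
    (hc : ∀ x : ℝ, (x : ℂ) ∈ ball (x₀ : ℂ) r → ContinuousWithinAt f {z : ℂ | 0 ≤ z.im} x)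
    (h0 : ∀ x : ℝ, (x : ℂ) ∈ ball (x₀ : ℂ) r → f x = 0) :
    EqOn f 0 (ball (x₀ : ℂ) r ∩ {z : ℂ | 0 < z.im}) := by
  have hU : IsOpen (ball (x₀ : ℂ) r) := isOpen_ball
  have hV : IsOpen (ball (x₀ : ℂ) r ∩ {z : ℂ | 0 < z.im}) :=
    hU.inter (isOpen_lt continuous_const continuous_im)
  -- Step 1: the reflected function is holomorphic on the disc
  have hF : DifferentiableOn ℂ (_root_.Complex.schwarzReflection f) (ball (x₀ : ℂ) r) := by
    refine _root_.Complex.differentiableOn_schwarzReflection hU (fun w hw => conj_mem_ball_ofReal hw)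
      ?_ hd ?_
    · rintro w ⟨hwU, hw⟩
      rcases eq_or_lt_of_le (show 0 ≤ w.im from hw) with him | him
      · obtain ⟨x, rfl⟩ : ∃ x : ℝ, (x : ℂ) = w :=
          ⟨w.re, Complex.ext (by simp) (by rw [ofReal_im]; exact him)⟩
        exact (hc x hwU).mono inter_subset_right
      · exact (hd.differentiableAt (hV.mem_nhds ⟨hwU, him⟩)).continuousAt.continuousWithinAt
    · intro w hwU hwim
      obtain ⟨x, rfl⟩ : ∃ x : ℝ, (x : ℂ) = w := ⟨w.re, Complex.ext (by simp) (by simp [hwim])⟩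
      rw [h0 x hwU, map_zero]
  have hFa : AnalyticOnNhd ℂ (_root_.Complex.schwarzReflection f) (ball (x₀ : ℂ) r) :=
    hF.analyticOnNhd hU
  -- Step 2: it vanishes on the whole disc (its zeros on the diameter accumulate at `x₀`)
  have hx₀mem : ((x₀ : ℝ) : ℂ) ∈ ball (x₀ : ℂ) r := mem_ball_self hr
  have hev : ∀ᶠ w in 𝓝 ((x₀ : ℝ) : ℂ), _root_.Complex.schwarzReflection f w = 0 := by
    refine ((hFa _ hx₀mem).frequently_zero_iff_eventually_zero).1 ?_
    have hrealev : ∀ᶠ t : ℝ in 𝓝 x₀, _root_.Complex.schwarzReflection f t = 0 := by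
      have : ∀ᶠ t : ℝ in 𝓝 x₀, (t : ℂ) ∈ ball (x₀ : ℂ) r :=
        Complex.continuous_ofReal.continuousAt.preimage_mem_nhds (hU.mem_nhds hx₀mem)
      filter_upwards [this] with t ht
      rw [_root_.Complex.schwarzReflection_ofReal, h0 t ht]
    have htend : Tendsto (fun t : ℝ => (t : ℂ)) (𝓝[≠] x₀) (𝓝[≠] ((x₀ : ℝ) : ℂ)) := by
      refine Complex.continuous_ofReal.continuousWithinAt.tendsto_nhdsWithin ?_
      intro t ht
      simpa using ht
    simpa using htend.frequently (eventually_nhdsWithin_of_eventually_nhds hrealev).frequently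
  have hFball : EqOn (_root_.Complex.schwarzReflection f) 0 (ball (x₀ : ℂ) r) :=
    hFa.eqOn_zero_of_preconnected_of_eventuallyEq_zero (convex_ball _ _).isPreconnected hx₀mem hev
  -- Step 3: on the upper half-disc the reflection is `f` itself
  rintro w ⟨hwU, hwim⟩
  have h1 := hFball hwU
  rw [Pi.zero_apply, _root_.Complex.schwarzReflection_of_nonneg (le_of_lt hwim)] at h1
  exact h1

end Literature.Analysis.Complex
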